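import Summits.HodgeConjecture.HodgeConjecture.Theorems.Ring2WeilCoverageNormClassEq
import Summits.HodgeConjecture.HodgeConjecture.Theorems.Ring2WeilNormObstructionDescentCensus
import HarnessLib

/-!
# Weil-type family coverage — THEOREM S6 (product-window law), part E: COROLLARY S6′ in arithmetic form and the degree-6 windows

research route conditional on HC_CM; not a corollary; Q11.4-sentence-2 already refuted in dim ≥ 3.

Ring 2, WEIL-TYPE FAMILY-COVERAGE CENSUS (`## b04`, block b04.13 P.S. 4–5, owner ring2-b04, gen 49); fifth part of
`Ring2WeilCoverageProductWindow` (same imports as part A; self-contained: the square identities `(2nh)^r(2h)^{r+2k} = (2^{r+k}h^{r+k})²·n^r`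
and `(nh)^r h^{r+2k} = (h^{r+k})²·n^r` are used directly).
* §1 COROLLARY S6′(i), arithmetic form: if `n ∈ Nm(K_dˣ)` then the class THEOREM S6 predicts for a Weil-type hidden factor,
  `[(2nh)^r (2h)^{r+2k}]` (`γ = 2`, `K = ℚ(√-3)`) resp. `[(nh)^r h^{r+2k}]` (`γ = 1`, `K = ℚ(i)`), is the NORM class for EVERY `r` — the
  product window `C_k × G₂` never leaves the split row when the degree `n` of `G₂` is a norm (`C₃ × S₃/A₄/S₄/AGL(1,7)/PSL₂(7)`-on-7,
  `C₄ × F₂₀/A₅/S₅`, … — the SHARP TESTS of part C are instances, and `C₃ × PSL₂(7)` is the pre-registered one of b04.13 P.S. 3).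
* §3 the two `C₃ × PSL₂(7)` data of kit j196600 (genus 64, 73; `r₁ = 1`, `(1,1)` surfaces): literal determinants, SPLIT — the prediction met.
* §2 the DEGREE-6 windows of ring2-b06's b06.20 P.S. 2 (`PGL₂(5) ≅ S₅` on the six points of `ℙ¹(𝔽₅)`, `|H| = 20`): over `ℚ(√-3)`
  the predicted class for odd `r₁` is `[6] = [2]` (R1 = `W6.3.2`), over `ℚ(i)` it is `[6] = [3]` (R3 = `W6.1.3`) (`6·2 = 12 = 3² + 3·1²`
  is a norm from `ℚ(√-3)`; `6·3 = 18 = 3² + 3²` is a norm from `ℚ(i)`).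
No `def`, no named fact, no `sorry`; nothing about Hodge classes; `HC_CM` used nowhere.  References: [cite: vanGeemen1994HodgeAV, (5.4.1), Lemma 5.2].
-/

set_option linter.dupNamespace false

open Literature.AlgebraicGeometry.Motives
open Literature.AlgebraicGeometry.VanGeemen1994
open Summit.HodgeConjecture.HodgeConjecture.Ring2.Hypotheses

namespace Summit.HodgeConjecture.HodgeConjecture.Ring2.WeilCoverage

/-! ### §1 COROLLARY S6′(i): a norm degree keeps every hidden factor on the split row -/

/-- **COROLLARY S6′(i), `γ = 2` (`K = ℚ(√-3)`-type bookkeeping, any `d`).** If `n` is a norm from `K_d` then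
`(2nh)^r (2h)^{r+2k}` is a norm for every `r, k`: by `productWindow_mk_eq_mk_pow` its class is `[n^r] = [n]^r = 1`.
research route conditional on HC_CM; not a corollary; Q11.4-sentence-2 already refuted in dim ≥ 3. [cite: vanGeemen1994HodgeAV, Lemma 5.2 (3)] -/
theorem productWindow_mem_norm_of_mem (d n h r k : ℕ) (hn : (n : ℚ) ≠ 0) (hh : (h : ℚ) ≠ 0)
    (hnorm : Units.mk0 (n : ℚ) hn ∈ normUnitsSubgroup ℚ (weilField d)) :
    Units.mk0 ((2 * (n : ℚ) * h) ^ r * (2 * (h : ℚ)) ^ (r + 2 * k))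
        (mul_ne_zero (pow_ne_zero _ (by positivity)) (pow_ne_zero _ (by positivity))) ∈ normUnitsSubgroup ℚ (weilField d) := by
  have hs : ((2 : ℚ) ^ (r + k) * (h : ℚ) ^ (r + k)) ≠ 0 := by positivity
  have e : Units.mk0 ((2 * (n : ℚ) * h) ^ r * (2 * (h : ℚ)) ^ (r + 2 * k))
        (mul_ne_zero (pow_ne_zero _ (by positivity)) (pow_ne_zero _ (by positivity))) =
      Units.mk0 (((2 : ℚ) ^ (r + k) * (h : ℚ) ^ (r + k)) ^ 2) (pow_ne_zero 2 hs) * (Units.mk0 (n : ℚ) hn) ^ r :=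
    Units.ext (by simp; ring)
  rw [e]
  exact Subgroup.mul_mem _ (sq_mem_normUnitsSubgroup hs) (Subgroup.pow_mem _ hnorm r)

/-- **COROLLARY S6′(i), `γ = 1` (`K = ℚ(i)`-type bookkeeping, any `d`).** If `n` is a norm from `K_d` then `(nh)^r h^{r+2k}` is a
norm for every `r, k`.
research route conditional on HC_CM; not a corollary; Q11.4-sentence-2 already refuted in dim ≥ 3. [cite: vanGeemen1994HodgeAV, Lemma 5.2 (3)] -/
theorem productWindow_mem_norm_of_mem' (d n h r k : ℕ) (hn : (n : ℚ) ≠ 0) (hh : (h : ℚ) ≠ 0)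
    (hnorm : Units.mk0 (n : ℚ) hn ∈ normUnitsSubgroup ℚ (weilField d)) :
    Units.mk0 (((n : ℚ) * h) ^ r * (h : ℚ) ^ (r + 2 * k))
        (mul_ne_zero (pow_ne_zero _ (by positivity)) (pow_ne_zero _ (by positivity))) ∈ normUnitsSubgroup ℚ (weilField d) := by
  have hs : ((h : ℚ) ^ (r + k)) ≠ 0 := by positivity
  have e : Units.mk0 (((n : ℚ) * h) ^ r * (h : ℚ) ^ (r + 2 * k))
        (mul_ne_zero (pow_ne_zero _ (by positivity)) (pow_ne_zero _ (by positivity))) =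
      Units.mk0 (((h : ℚ) ^ (r + k)) ^ 2) (pow_ne_zero 2 hs) * (Units.mk0 (n : ℚ) hn) ^ r :=
    Units.ext (by simp; ring)
  rw [e]
  exact Subgroup.mul_mem _ (sq_mem_normUnitsSubgroup hs) (Subgroup.pow_mem _ hnorm r)

/-- The sharp test `C₃ × S₄` (`n = 4 = 2²`, `|H| = 6`, `K = ℚ(√-3)`): the predicted class is a norm for EVERY `r₁` — the factors of
part C (genus 16/19/25, `r₁ = 1`) are split, as computed.
research route conditional on HC_CM; not a corollary; Q11.4-sentence-2 already refuted in dim ≥ 3. [cite: vanGeemen1994HodgeAV, (5.4.1)] -/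
theorem productWindow_C3S4_mem_norm (r k : ℕ) :
    Units.mk0 ((2 * (4 : ℚ) * 6) ^ r * (2 * (6 : ℚ)) ^ (r + 2 * k))
        (mul_ne_zero (pow_ne_zero _ (by positivity)) (pow_ne_zero _ (by positivity))) ∈ normUnitsSubgroup ℚ (weilField 3) := by
  have := productWindow_mem_norm_of_mem 3 4 6 r k (by norm_num) (by norm_num)
    (mem_normUnitsSubgroup_of_sq_add_mul_sq _ 2 0 (by norm_num))
  exact_mod_cast this

/-- The sharp test `C₄ × F₂₀` (`n = 5 = 1 + 2²` a norm from `ℚ(i)`, `|H| = 4`): the predicted class is a norm for EVERY `r₁` — the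
factors of part C (genus 11/19/31, `r₁ = 1`, `5 ∣ det H`) are split, as computed.
research route conditional on HC_CM; not a corollary; Q11.4-sentence-2 already refuted in dim ≥ 3. [cite: vanGeemen1994HodgeAV, (5.4.1)] -/
theorem productWindow_C4F20_mem_norm (r k : ℕ) :
    Units.mk0 (((5 : ℚ) * 4) ^ r * (4 : ℚ) ^ (r + 2 * k))
        (mul_ne_zero (pow_ne_zero _ (by positivity)) (pow_ne_zero _ (by positivity))) ∈ normUnitsSubgroup ℚ (weilField 1) := by
  have := productWindow_mem_norm_of_mem' 1 5 4 r k (by norm_num) (by norm_num)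
    (mem_normUnitsSubgroup_of_sq_add_mul_sq _ 1 2 (by norm_num))
  exact_mod_cast this

/-- The sharp test `C₃ × PSL₂(7)` on 7 points (`n = 7 = 2² + 3·1²` a norm from `ℚ(√-3)`, `|H| = 24`): the predicted class is a norm for
EVERY `r₁` although THEOREM S3 alone allows `[2]` there (the `2`-defect of `ρ₆` is positive) — the PRE-REGISTERED prediction of census
b04.13 P.S. 3 (Q4) for kit j196600 — RETURNED split, §3.
research route conditional on HC_CM; not a corollary; Q11.4-sentence-2 already refuted in dim ≥ 3. [cite: vanGeemen1994HodgeAV, (5.4.1)] -/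
theorem productWindow_C3L27_mem_norm (r k : ℕ) :
    Units.mk0 ((2 * (7 : ℚ) * 24) ^ r * (2 * (24 : ℚ)) ^ (r + 2 * k))
        (mul_ne_zero (pow_ne_zero _ (by positivity)) (pow_ne_zero _ (by positivity))) ∈ normUnitsSubgroup ℚ (weilField 3) := by
  have := productWindow_mem_norm_of_mem 3 7 24 r k (by norm_num) (by norm_num)
    (mem_normUnitsSubgroup_of_sq_add_mul_sq _ 2 1 (by norm_num))
  exact_mod_cast this

/-! ### §2 The degree-6 windows (`PGL₂(5) ≅ S₅` on six points, `|H| = 20`) of census b06.20 P.S. 2 -/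

/-- `K = ℚ(√-3)`, `C₃ × PGL₂(5)`, `r₁ = 2j + 1` odd: the predicted class `[240^{r₁}·40^{r₁+m}] = [6] = [2]` is NOT a norm class —
the hidden factor lies on R1 = `W6.3.2` (ring2-b06's genus-166 datum `(0; c0:222, c1:4, c1:22, c1:33)`; ring2-b02's
`two_not_mem_norm_three`; `6 · 2 = 12 = 3² + 3·1²`).
research route conditional on HC_CM; not a corollary; Q11.4-sentence-2 already refuted in dim ≥ 3. [cite: vanGeemen1994HodgeAV, (5.4.1)] -/
theorem productWindow_C3PGL25_odd_not_mem_norm (j k : ℕ) :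
    Units.mk0 ((2 * (6 : ℚ) * 20) ^ (2 * j + 1) * (2 * (20 : ℚ)) ^ (2 * j + 1 + 2 * k))
        (mul_ne_zero (pow_ne_zero _ (by positivity)) (pow_ne_zero _ (by positivity))) ∉ normUnitsSubgroup ℚ (weilField 3) := by
  intro hmem
  -- x = t² · 6 with t = 240^j · 40^{j+k+1} (240·40 = 6·40²), and 2 = 12 · 6⁻¹ with 12 a norm: reduce to `2 ∉ Nm`
  have ht : ((240 : ℚ) ^ j * (40 : ℚ) ^ (j + k + 1)) ≠ 0 := by positivity
  have e : Units.mk0 ((2 * (6 : ℚ) * 20) ^ (2 * j + 1) * (2 * (20 : ℚ)) ^ (2 * j + 1 + 2 * k))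
        (mul_ne_zero (pow_ne_zero _ (by positivity)) (pow_ne_zero _ (by positivity))) =
      Units.mk0 (((240 : ℚ) ^ j * (40 : ℚ) ^ (j + k + 1)) ^ 2) (pow_ne_zero 2 ht) *
        Units.mk0 (6 : ℚ) (by norm_num) := Units.ext (by simp; ring)
  rw [e] at hmem
  have h6 : Units.mk0 (6 : ℚ) (by norm_num) ∈ normUnitsSubgroup ℚ (weilField 3) := by
    have := Subgroup.mul_mem _ (Subgroup.inv_mem _ (sq_mem_normUnitsSubgroup (d := 3) ht)) hmem
    rwa [inv_mul_cancel_left] at this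
  have h12 : Units.mk0 (12 : ℚ) (by norm_num) ∈ normUnitsSubgroup ℚ (weilField 3) :=
    mem_normUnitsSubgroup_of_sq_add_mul_sq _ 3 1 (by norm_num)
  have e2 : Units.mk0 (2 : ℚ) (by norm_num) = Units.mk0 (12 : ℚ) (by norm_num) * (Units.mk0 (6 : ℚ) (by norm_num))⁻¹ :=
    Units.ext (by simp; norm_num)
  apply Summit.HodgeConjecture.Ring2WeilNormDescent.two_not_mem_norm_three
  rw [e2]
  exact Subgroup.mul_mem _ h12 (Subgroup.inv_mem _ h6)

/-- `K = ℚ(i)`, `C₄ × PGL₂(5)`, `r₁ = 2j + 1` odd: the predicted class `[120^{r₁}·20^{r₁+m}] = [6] = [3]` is NOT a norm class — the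
hidden factor lies on R3 = `W6.1.3` (ring2-b06's genus-161 datum; `6 · 3 = 18 = 3² + 3²`; ring2-b02's `three_not_mem_norm_one`).
research route conditional on HC_CM; not a corollary; Q11.4-sentence-2 already refuted in dim ≥ 3. [cite: vanGeemen1994HodgeAV, (5.4.1)] -/
theorem productWindow_C4PGL25_odd_not_mem_norm (j k : ℕ) :
    Units.mk0 (((6 : ℚ) * 20) ^ (2 * j + 1) * (20 : ℚ) ^ (2 * j + 1 + 2 * k))
        (mul_ne_zero (pow_ne_zero _ (by positivity)) (pow_ne_zero _ (by positivity))) ∉ normUnitsSubgroup ℚ (weilField 1) := by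
  intro hmem
  have ht : ((120 : ℚ) ^ j * (20 : ℚ) ^ (j + k + 1)) ≠ 0 := by positivity
  have e : Units.mk0 (((6 : ℚ) * 20) ^ (2 * j + 1) * (20 : ℚ) ^ (2 * j + 1 + 2 * k))
        (mul_ne_zero (pow_ne_zero _ (by positivity)) (pow_ne_zero _ (by positivity))) =
      Units.mk0 (((120 : ℚ) ^ j * (20 : ℚ) ^ (j + k + 1)) ^ 2) (pow_ne_zero 2 ht) *
        Units.mk0 (6 : ℚ) (by norm_num) := Units.ext (by simp; ring)
  rw [e] at hmem
  have h6 : Units.mk0 (6 : ℚ) (by norm_num) ∈ normUnitsSubgroup ℚ (weilField 1) := by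
    have := Subgroup.mul_mem _ (Subgroup.inv_mem _ (sq_mem_normUnitsSubgroup (d := 1) ht)) hmem
    rwa [inv_mul_cancel_left] at this
  have h18 : Units.mk0 (18 : ℚ) (by norm_num) ∈ normUnitsSubgroup ℚ (weilField 1) :=
    mem_normUnitsSubgroup_of_sq_add_mul_sq _ 3 3 (by norm_num)
  have e3 : Units.mk0 (3 : ℚ) (by norm_num) = Units.mk0 (18 : ℚ) (by norm_num) * (Units.mk0 (6 : ℚ) (by norm_num))⁻¹ :=
    Units.ext (by simp; norm_num)
  apply Summit.HodgeConjecture.Ring2WeilNormDescent.three_not_mem_norm_one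
  rw [e3]
  exact Subgroup.mul_mem _ h18 (Subgroup.inv_mem _ h6)

/-! ### §3 The `C₃ × PSL₂(7)` sharp test RETURNED (kit j196600): split, as §1's `productWindow_C3L27_mem_norm` predicted -/

/-- `C3xL27`-cover `(0; c1:33,c1:33,c1:42)` (genus 64, Hurwitz dimension 0; engine `prodwin.py`, exact): the HIDDEN FACTOR `B = V^{H₁×Stab(0)}` of the `(λ⊗ρ)`-piece `P ~ B^{6}` (census row of `P`: `W12.3.1`) — an abelian SURFACE with `(1,1)` `ℚ(√-3)`-action, WEIL TYPE — has literal `det H|_B = -37773/263452`, `a = 37773/263452`, `T(a) = []`: row `W2.3.1` (SPLIT); `r₁ = dim_K H¹(C̃/G₂)_λ = 1`.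
research route conditional on HC_CM; not a corollary; Q11.4-sentence-2 already refuted in dim ≥ 3. [cite: vanGeemen1994HodgeAV, (5.4.1)] -/
theorem pwC3L27_c133_c133_c142_q0_g64_mk_detH_eq_split :
    (QuotientGroup.mk (Units.mk0 (((-37773 : ℚ) / 263452)) (by norm_num)) : weilNormResidueGroup 3) =
      splitDiscriminantClass 1 3 := by
  have e : Units.mk0 (((-37773 : ℚ) / 263452)) (by norm_num) = -(Units.mk0 ((37773 : ℚ) / 263452) (by norm_num)) := Units.ext (by norm_num)
  rw [e, mk_neg_eq_splitDiscriminantClass_iff_of_odd (n := 1) (by decide)]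
  exact mem_normUnitsSubgroup_of_sq_add_mul_sq _ ((-711 : ℚ) / 2716) ((429 : ℚ) / 2716) (by norm_num)

/-- `C3xL27`-cover `(0; c1:33,c1:33,c1:7A)` (genus 73, Hurwitz dimension 0; engine `prodwin.py`, exact): the HIDDEN FACTOR `B = V^{H₁×Stab(0)}` of the `(λ⊗ρ)`-piece `P ~ B^{6}` (census row of `P`: `W12.3.1`) — an abelian SURFACE with `(1,1)` `ℚ(√-3)`-action, WEIL TYPE — has literal `det H|_B = -1204572/6518575`, `a = 1204572/6518575`, `T(a) = []`: row `W2.3.1` (SPLIT); `r₁ = dim_K H¹(C̃/G₂)_λ = 1`.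
research route conditional on HC_CM; not a corollary; Q11.4-sentence-2 already refuted in dim ≥ 3. [cite: vanGeemen1994HodgeAV, (5.4.1)] -/
theorem pwC3L27_c133_c133_c17A_q0_g73_mk_detH_eq_split :
    (QuotientGroup.mk (Units.mk0 (((-1204572 : ℚ) / 6518575)) (by norm_num)) : weilNormResidueGroup 3) =
      splitDiscriminantClass 1 3 := by
  have e : Units.mk0 (((-1204572 : ℚ) / 6518575)) (by norm_num) = -(Units.mk0 ((1204572 : ℚ) / 6518575) (by norm_num)) := Units.ext (by norm_num)
  rw [e, mk_neg_eq_splitDiscriminantClass_iff_of_odd (n := 1) (by decide)]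
  exact mem_normUnitsSubgroup_of_sq_add_mul_sq _ ((-2319 : ℚ) / 6755) ((1009 : ℚ) / 6755) (by norm_num)

end Summit.HodgeConjecture.HodgeConjecture.Ring2.WeilCoverage
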